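import Literature.NumberTheory.LFunctions.ZeroDetectionThreeHalves
import Literature.NumberTheory.LFunctions.MontgomeryLargeValuesConjecture
import HarnessLib

/-!
# The Montgomery large value conjecture implies the density hypothesis (Tao–Trudgian–Yang, Theorem 45)

LABEL (line 1): **NOT RH-BEARING** — an implication between two OPEN conjectures of the tree
(`MontgomeryLargeValueConjecture`, Guth–Maynard's Conjecture 1.5 form, and rh.S13
`DensityHypothesis`), proved as a theorem; neither conjecture is asserted, and a zero-density
COUNT never empties the strip (`Literature.Barriers.RiemannHypothesis.LindelofBacklund`). RH-FREE
literature. Nothing in this file bears on the truth of RH.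

Topic `NumberTheory/LFunctions`, family RH; bears on the LADDER-RH §4 HELD row `DensityLadder`,
crux X2 `DensityBelowBourgain`: its line of attack takes as INPUT the stub LV
"`LargeValuesDHStrength σ` strictly left of `25/32`" and records (sorry-free, in the Summits file)
that Montgomery's conjecture implies that input for every `σ > 1/2`; composed with the tree's zero
detection at `τ₀ = 3/2` (`isBigO_zetaZeroCountRe_of_largeValuesDHStrength`,
`ZeroDetectionThreeHalves.lean`) this is the printed theorem below.

Source: T. Tao, T. Trudgian, A. Yang, *New exponent pairs, zero density estimates, and zero additive
energy estimates: a systematic approach* (arXiv:2501.16779, 2025), §6, **Theorem 45**: "The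
Montgomery conjecture implies the density hypothesis. *Proof.* Apply Corollary 43 with `τ₀ = 3/2`
(so that (lvoz) is vacuously true)." (Their Montgomery conjecture: `LV(σ, τ) ≤ 2 − 2σ`, i.e. for
large value patterns with `V = N^{σ+o(1)}`, `|W| ≲ N^{2−2σ+o(1)}`; the tree's
`MontgomeryLargeValueConjecture` is Guth–Maynard's Conjecture 1.5, the same in the regime
`N ≤ T ≤ N^A`, which contains the window `T^{2/3} ≤ N ≤ T` used at `τ₀ = 3/2`.) Classical
antecedent: H. L. Montgomery, *Topics in multiplicative number theory*, LNM 227 (1971), ch. 12.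

## What this file proves (theorems only; no definition, no named fact)

* `densityHypothesis_of_montgomeryLargeValueConjecture :
  MontgomeryLargeValueConjecture → DensityHypothesis` (TTY Theorem 45). For `1/2 < σ < 1`: the
  conjecture in the regime `N ≤ T ≤ N^{3/2}` at exponent `σ − δ` gives density-strength large
  values on `T^{2/3} ≤ N ≤ T` (`ZeroDetectionDH.largeValuesDHStrength_of_montgomery`: peel the
  first term of the `Icc`-block, `N^{σ−δ/2} ≥ N^{σ−δ} + 2` once `N^{δ/2} ≥ 3`, and
  `T^{ε/2} N^{2−2(σ−δ)} ≤ T^{2(1−σ)+ε}` for `4δ ≤ ε`; the same computation as the calibration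
  `largeValuesDHStrength_of_LVC` of the crux line), then zero detection at `τ₀ = 3/2`; `σ = 1/2`
  is `N(1/2, T) ≤ N(T) ≪ T log T` and `σ = 1` is `N(1, T) = 0`.

## References

* T. Tao, T. Trudgian, A. Yang, arXiv:2501.16779 (2025), §6: Definition 27, Conjecture 38
  (density hypothesis), Corollary 43, Theorem 45. [`TaoTrudgianYang2025`]
* L. Guth, J. Maynard, *New large value estimates for Dirichlet polynomials*, Ann. of Math. (2) 203
  (2026), Conjecture 1.5. [`GuthMaynard2026`]
* H. L. Montgomery, *Topics in multiplicative number theory*, Lecture Notes in Math. 227, Springer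
  1971, ch. 12. [`Montgomery1971`]
-/

noncomputable section

open Real Filter Topology Complex Finset Asymptotics

namespace Literature.NumberTheory.LFunctions

namespace ZeroDetectionDH

/-- **Montgomery's conjecture gives density-strength large values on `T^{2/3} ≤ N ≤ T`** for every
`1/2 < σ ≤ 1` (the hypothesis of `isBigO_zetaZeroCountRe_of_largeValuesDHStrength`, verbatim the
crux line's `LargeValuesDHStrength σ`): apply `MontgomeryLargeValueConjecture` at exponent `σ − δ`,
`δ = min(ε/4, (σ − 1/2)/2)`, in the regime `N ≤ T ≤ N^{3/2}` with tolerance `ε/2`, after peeling the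
first term of the `Icc`-block (`N^{σ−δ/2} ≥ N^{σ−δ} + 2` once `N^{δ/2} ≥ 3`, i.e.
`T ≥ 3^{3/δ}`); then `C T^{ε/2} N^{2−2(σ−δ)} ≤ max(C,0) T^{2(1−σ)+ε}`. (TTY: "we automatically
verify (lvo) in regimes where the Montgomery conjecture holds", remark after Corollary 43.)
[cite: TaoTrudgianYang2025, Corollary 43 and the remark following it] -/
theorem largeValuesDHStrength_of_montgomery (hLVC : MontgomeryLargeValueConjecture) {σ : ℝ}
    (hσ : 1 / 2 < σ) (hσ1 : σ ≤ 1) :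
    ∀ ε : ℝ, 0 < ε → ∃ δ C T₀ : ℝ, 0 < δ ∧ ∀ T : ℝ, T₀ ≤ T →
      ∀ (N : ℕ) (b : ℕ → ℂ) (W : Finset ℝ), T ^ (2 / 3 : ℝ) ≤ (N : ℝ) → (N : ℝ) ≤ T →
      (∀ n, ‖b n‖ ≤ 1) → (∀ t ∈ W, 0 ≤ t ∧ t ≤ T) →
      (∀ t ∈ W, ∀ t' ∈ W, t ≠ t' → 1 ≤ |t - t'|) →
      (∀ t ∈ W, (N : ℝ) ^ (σ - δ) ≤
        ‖∑ n ∈ Finset.Icc N (2 * N), b n * (n : ℂ) ^ ((t : ℂ) * I)‖) →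
      (W.card : ℝ) ≤ C * T ^ (2 * (1 - σ) + ε) := by
  intro ε hε
  -- parameters
  set δ : ℝ := min (ε / 4) ((σ - 1 / 2) / 2) with hδdef
  have hδ0 : 0 < δ := lt_min (by linarith) (by linarith)
  have hδε : 4 * δ ≤ ε := by linarith [min_le_left (ε / 4) ((σ - 1 / 2) / 2)]
  have hσδ : 1 / 2 < σ - δ := by linarith [min_le_right (ε / 4) ((σ - 1 / 2) / 2)]
  obtain ⟨C, hC⟩ := hLVC (σ - δ) hσδ (3 / 2) (by norm_num) (ε / 2) (by linarith)
  -- thresholds: `T ≥ T₀ := 3^{3/δ}` gives `N ≥ T^{2/3} ≥ 3^{2/δ}`, so `N^{δ/2} ≥ 3`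
  refine ⟨δ / 2, max C 0, (3 : ℝ) ^ (3 / δ), by linarith, ?_⟩
  intro T hT N b W hNlo hNhi hb hW hsep hlarge
  have h3pos : (0 : ℝ) < (3 : ℝ) ^ (3 / δ) := Real.rpow_pos_of_pos (by norm_num) _
  have h3one : (1 : ℝ) ≤ (3 : ℝ) ^ (3 / δ) := Real.one_le_rpow (by norm_num) (by positivity)
  have hT1 : 1 ≤ T := h3one.trans hT
  have hT0 : 0 < T := by linarith
  have hN1 : (1 : ℝ) ≤ N := le_trans (Real.one_le_rpow hT1 (by norm_num)) hNlo
  have hN0 : (0 : ℝ) < N := by linarith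
  have hNpos : 0 < N := by exact_mod_cast hN0
  -- `N^{δ/2} ≥ 3`
  have hNδ : (3 : ℝ) ≤ (N : ℝ) ^ (δ / 2) := by
    have h1 : (3 : ℝ) ^ (3 / δ) ≤ T := hT
    have h2 : T ^ (2 / 3 : ℝ) ≤ N := hNlo
    have h3 : ((3 : ℝ) ^ (3 / δ)) ^ (2 / 3 : ℝ) ≤ T ^ (2 / 3 : ℝ) :=
      Real.rpow_le_rpow h3pos.le h1 (by norm_num)
    have h4 : ((3 : ℝ) ^ (3 / δ)) ^ (2 / 3 : ℝ) = (3 : ℝ) ^ (2 / δ) := by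
      rw [← Real.rpow_mul (by norm_num)]; congr 1; field_simp
    have h5 : (3 : ℝ) ^ (2 / δ) ≤ N := by rw [← h4]; exact h3.trans h2
    have h6 : ((3 : ℝ) ^ (2 / δ)) ^ (δ / 2) ≤ (N : ℝ) ^ (δ / 2) :=
      Real.rpow_le_rpow (Real.rpow_nonneg (by norm_num) _) h5 (by linarith)
    have h7 : ((3 : ℝ) ^ (2 / δ)) ^ (δ / 2) = 3 := by
      rw [← Real.rpow_mul (by norm_num)]
      have : 2 / δ * (δ / 2) = 1 := by field_simp
      rw [this, Real.rpow_one]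
    rw [← h7]; exact h6
  -- regime `T ≤ N^{3/2}`
  have hTN : T ≤ (N : ℝ) ^ (3 / 2 : ℝ) := by
    have h1 : (T ^ (2 / 3 : ℝ)) ^ (3 / 2 : ℝ) = T := by
      rw [← Real.rpow_mul hT0.le]; norm_num
    rw [← h1]
    exact Real.rpow_le_rpow (Real.rpow_nonneg hT0.le _) hNlo (by norm_num)
  -- the `Icc`-block in `cpow` form, minus its first term, is the `Ioc`-block in `exp` form
  have hsumeq : ∀ t : ℝ, ∑ n ∈ Finset.Icc N (2 * N), b n * (n : ℂ) ^ ((t : ℂ) * I) =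
      b N * (N : ℂ) ^ ((t : ℂ) * I) +
        ∑ n ∈ Finset.Ioc N (2 * N), b n * Complex.exp (I * (t : ℂ) * (Real.log n : ℂ)) := by
    intro t
    rw [← Finset.sum_Ioc_add_eq_sum_Icc (by omega : N ≤ 2 * N), add_comm]
    congr 1
    refine Finset.sum_congr rfl fun n hn ↦ ?_
    have hn0 : 0 < n := lt_of_le_of_lt (Nat.zero_le N) (Finset.mem_Ioc.mp hn).1
    have hn0' : (n : ℂ) ≠ 0 := by exact_mod_cast hn0.ne'
    rw [Complex.cpow_def_of_ne_zero hn0', ← Complex.natCast_log]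
    congr 1
    ring_nf
  -- `‖b N · N^{it}‖ ≤ 1`
  have hfirst : ∀ t : ℝ, ‖b N * (N : ℂ) ^ ((t : ℂ) * I)‖ ≤ 1 := by
    intro t
    rw [norm_mul, Complex.norm_natCast_cpow_of_pos hNpos]
    simp only [mul_re, ofReal_re, I_re, mul_zero, ofReal_im, I_im, mul_one, sub_self,
      Real.rpow_zero, mul_one]
    exact hb N
  -- strict large values `> N^{σ-δ}` of the `Ioc`-block in `exp` form
  have hlarge' : ∀ t ∈ W, (N : ℝ) ^ (σ - δ) <
      ‖∑ n ∈ Finset.Ioc N (2 * N), b n * Complex.exp (I * (t : ℂ) * (Real.log n : ℂ))‖ := by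
    intro t ht
    have h := hlarge t ht
    rw [hsumeq] at h
    have htri := norm_add_le (b N * (N : ℂ) ^ ((t : ℂ) * I))
      (∑ n ∈ Finset.Ioc N (2 * N), b n * Complex.exp (I * (t : ℂ) * (Real.log n : ℂ)))
    have hfirst' := hfirst t
    -- `N^{σ-δ/2} = N^{σ-δ} N^{δ/2} ≥ 3 N^{σ-δ} ≥ N^{σ-δ} + 2`, `N^{σ-δ} ≥ 1`
    have hpow : (N : ℝ) ^ (σ - δ / 2) = (N : ℝ) ^ (σ - δ) * (N : ℝ) ^ (δ / 2) := by
      rw [← Real.rpow_add hN0]; congr 1; ring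
    have hone : (1 : ℝ) ≤ (N : ℝ) ^ (σ - δ) := Real.one_le_rpow hN1 (by linarith)
    have hge : (N : ℝ) ^ (σ - δ) + 2 ≤ (N : ℝ) ^ (σ - δ / 2) := by
      rw [hpow]
      nlinarith [hNδ, hone]
    linarith
  -- apply the conjecture
  have hcount := hC N T b W hNhi hTN hb hW hsep hlarge'
  -- compare the bounds: `C T^{ε/2} N^{2-2(σ-δ)} ≤ max C 0 · T^{2(1-σ)+ε}`
  have hexp0 : 0 ≤ 2 - 2 * (σ - δ) := by linarith
  have hNT : (N : ℝ) ^ (2 - 2 * (σ - δ)) ≤ T ^ (2 - 2 * (σ - δ)) :=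
    Real.rpow_le_rpow hN0.le hNhi hexp0
  have hTT : T ^ (ε / 2) * T ^ (2 - 2 * (σ - δ)) ≤ T ^ (2 * (1 - σ) + ε) := by
    rw [← Real.rpow_add hT0]
    exact Real.rpow_le_rpow_of_exponent_le hT1 (by linarith)
  have hC0 : C ≤ max C 0 := le_max_left _ _
  have hM0 : 0 ≤ max C 0 := le_max_right _ _
  calc (W.card : ℝ) ≤ C * T ^ (ε / 2) * (N : ℝ) ^ (2 - 2 * (σ - δ)) := hcount
    _ ≤ max C 0 * T ^ (ε / 2) * (N : ℝ) ^ (2 - 2 * (σ - δ)) := by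
        gcongr
    _ ≤ max C 0 * T ^ (ε / 2) * T ^ (2 - 2 * (σ - δ)) := by
        gcongr
    _ = max C 0 * (T ^ (ε / 2) * T ^ (2 - 2 * (σ - δ))) := by ring
    _ ≤ max C 0 * T ^ (2 * (1 - σ) + ε) := by
        gcongr

end ZeroDetectionDH

/-- **Tao–Trudgian–Yang 2025, Theorem 45: "The Montgomery conjecture implies the density
hypothesis."** In the tree's vocabulary: Guth–Maynard's form of Montgomery's large value conjecture
(`MontgomeryLargeValueConjecture`, Conjecture 1.5, regime `N ≤ T ≤ N^A`) implies rh.S13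
`DensityHypothesis` (`N(σ, T) ≪_{ε,σ} T^{2(1−σ)+ε}` for `1/2 ≤ σ ≤ 1`). Proof as printed — "Apply
Corollary 43 with `τ₀ = 3/2`": for `1/2 < σ < 1` the conjecture gives density-strength large values
on `T^{2/3} ≤ N ≤ T` (`ZeroDetectionDH.largeValuesDHStrength_of_montgomery`) and the zero detection
`isBigO_zetaZeroCountRe_of_largeValuesDHStrength` concludes; `σ = 1/2` is the trivial
`N(1/2, T) ≤ N(T) ≪ T log T ≪ T^{1+ε}`, `σ = 1` is `N(1, T) = 0`. Both sides are OPEN conjectures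
of the tree; this is the implication only. [cite: TaoTrudgianYang2025, Theorem 45] -/
theorem densityHypothesis_of_montgomeryLargeValueConjecture (hLVC : MontgomeryLargeValueConjecture) :
    DensityHypothesis := by
  intro ε hε σ hσ hσ1
  rcases hσ.eq_or_lt with h | hlt
  · -- `σ = 1/2`: `N(1/2, T) ≪ T log T ≪ T^{1+ε} = T^{2(1 − 1/2) + ε}`
    rw [← h, show (2 : ℝ) * (1 - 1 / 2) + ε = 1 + ε by ring]
    exact (isBigO_zetaZeroCountRe_mul_log (by norm_num)).trans (isBigO_mul_log_rpow hε)
  rcases hσ1.lt_or_eq with hlt1 | h1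
  · -- `1/2 < σ < 1`: zero detection at `τ₀ = 3/2`
    exact isBigO_zetaZeroCountRe_of_largeValuesDHStrength hlt hlt1
      (ZeroDetectionDH.largeValuesDHStrength_of_montgomery hLVC hlt hσ1) ε hε
  · -- `σ = 1`: the box is empty
    refine IsBigO.of_bound 0 (Eventually.of_forall fun T ↦ ?_)
    rw [h1, zetaZeroCountRe_eq_zero_of_one_le le_rfl T]
    simp

end Literature.NumberTheory.LFunctions

end
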